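import Literature.AnabelianGeometry.EtaleTheta.Discharge.Sec5OfThetaSettingQ
import Literature.AnabelianGeometry.EtaleTheta.Discharge.Sec5ThetaSubquotientSettingToLevelN
import Literature.AnabelianGeometry.EtaleTheta.Discharge.Sec5ThetaSubquotientLevelNOfConnectedTemperoid

/-!
# [EtTh] Prop. 5.5 at the §5 data OF THE SETTING in PRINT'S `Q`-currency: the base-point value of `P.proj ∘ ρ` and the
# binders `(e, he, hPproj)` DISCHARGED for `Q := (l·Δ_Θ)_(−)` pinned to the §1 setting

Mochizuki, *The étale theta function and its Frobenioid-theoretic manifestations*, Publ. RIMS **45** (2009), §5 p. 327 (PDF p. 101):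
"`(Π^tp_X)^Θ ⊇ l·Δ_Θ` … these subquotients determine subquotients `Aut_D(D) ↠ Aut^Θ_D(D)`; `(l·Δ_Θ)_D ⊆ Aut^Θ_D(D)`"; proof of Prop. 5.5,
pp. 327–328 (PDF pp. 101–102); Prop. 2.12 (i) p. 271 (PDF p. 45) / §2 p. 46 ("`l·Δ_Θ ↠ (l·Δ_Θ) ⊗ ℤ/Nℤ ≅ μ_N`").
[cite: MochizukiEtTh2009, Prop 5.5 p.327–328 (PDF pp.101–102)]

PROOF-ONLY (no definitions).  abc-iut cell, layer L2, seat abc-iut-L2-t9 (gen 4; unit W2-L2-05 lineage), row «R252 (b): hPproj AT PRINT'S `Q`»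
(L2-lead ROWS #14b).  CONTEXT: the §5 data OF THE SETTING (abc-iut-L2-t4's `ofThetaSettingDataQ`, `Discharge/Sec5OfThetaSettingQ.lean`): base
`B^temp(Π^tp_X̲̲)⁰` (`Π^tp_X̲̲ = C.Huu`), `T := C.thetaEnvData μ hC hS`, `ιX := id`, and the theta subquotients PINNED to print's pair
`(q, ι) = ((Π^tp_X ↠ (Π^tp_X)^Θ)|_{Π^tp_X̲̲}, l·Δ_Θ ↪ (Π^tp_X)^Θ)` (abc-iut-L2-t9's `ThetaSubquotient.ofSettingSub D l C.Huu`, carrier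
`LDelta (qSub D C.Huu) (ιTheta D l)`, `Aut`-subquotient `autPre ↠ (l·Δ_Θ)_E` via `autProj`); `ρ = rhoOfBiKummerData R id : Π^tp_X̲̲ → Aut_D(B_N^bs)`,
read on the underlying `Π^tp_X̲̲`-set through `(connectedObjects _).ι.mapAut`; `x := (s^⊓_N)^bs(x_{A_N})` the base point of `B_N^bs`.

WHAT IS PROVED (print's-`Q` twins of abc-iut-w4-d042's level-`N` laws p431034 / abc-iut-w5-d020's image-carrier discharge p433425–p437167):
* GENERIC LAYER (light context, namespace `ThetaSubquotient`; `ρ : Γ → Aut_D(E)` acting at a base point by `(ρ k)(x) = (φ k)⁻¹·x` as in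
  abc-iut-w4-d042's `Sec5ThetaSubquotientAutLaws`, a subgroup `Γ₀ ≤ Γ` with a "logarithm" `lg : Γ₀ → Λ`, `ι ∘ lg = q ∘ φ`, onto `Λ`):
  `mem_range_powMonoidHom_of_evalAt_eq` (an element of `(l·Δ_Θ)_E` whose value at one point is an `n`-th power is an `n`-th power),
  `mk_modPow_eq_of_evalAt_eq_inv` (mod `n`, an element is determined by its value read through any `red : Λ → M` with `Ker ⊆ Λ^n`),
  `exists_autProj_rho_eq_of_lg` (EVERY element of `(l·Δ_Θ)_E` is `autProj (ρ k)`, `k ∈ Γ₀`), **`exists_coeffMap_of_lg`** (the SURJECTIVE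
  coefficient map `e : M → (l·Δ_Θ)_E ⊗ ℤ/nℤ`, `mk (autProj (ρ k)) = e (red (lg k))`);
* `DoubleUnderline.toLDelta_surjective` — `toLDelta : q⁻¹(l·Δ_Θ) ∩ Π^tp_X̲̲ ↠ l·Δ_Θ` (the double underline situation `l·Δ_Θ ⊆ (Π^tp_X̲̲)^Θ`);
* **`evalAt_autProj_rho_ofThetaSetting`** — hP at the base point IN PRINT'S CURRENCY: for `k ∈ Π^tp_X̲̲` with `q(k) ∈ l·Δ_Θ`,
  `evalAt x (autProj (ρ k)) = [q(k)⁻¹] ∈ l·Δ_Θ / ι⁻¹J(Stab x)` — `toLDelta k` inverted, the inversion being `ρ(g)(x) = g⁻¹·x` ([SemiAnbd] Rmk. 3.1.3);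
  `…_of_toTheta_mem` the same with the membership clause `toTheta k ∈ l·Δ_Θ`; `mapAut_rho_mem_autPre_ofThetaSetting_of_mem` (hpre);
* `autProj_rho_modN_eq_of_thetaMod_eq` — MOD `N`, `autProj (ρ k)` depends only on `thetaMod k ∈ μ_N` (`Ker(red) = N`-th powers, `μ.red_ker`);
* `exists_autProj_rho_eq_ofThetaSetting` — EVERY element of `(l·Δ_Θ)_{B_N^bs}` is `autProj (ρ k)` for some `k ∈ Π^tp_X̲̲` with `q(k) ∈ l·Δ_Θ`;
* **`exists_coeffMap_autProj_ofThetaSetting`** — `(e, he, hPproj)` IN PRINT'S-`Q` CURRENCY (cheap spelling): there is a SURJECTIVE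
  `e : μ_N → (l·Δ_Θ)_{B_N^bs}(q, ι) ⊗ ℤ/Nℤ` with `mk (autProj (ρ k)) = e (thetaMod k)` for every `k ∈ Π^tp_X̲̲`, `q(k) ∈ l·Δ_Θ`;
* `settingToLevelN_autProj_rho`, **`evalAt_settingToLevelN_autProj_rho`** — the LEVEL-`N` READING through abc-iut-L2-t9's comparison
  `settingToLevelN` (p437963, "thetaMod-vs-evalEquiv"): `settingToLevelN (autProj_{(q,ι)} (ρ k)) = autProj_{(q_N,ι_N)} (ρ k)` and
  `evalAt_N x (settingToLevelN (autProj (ρ k))) = [(thetaMod k)⁻¹] ∈ μ_N / J_N(Stab x)` — abc-iut-w4-d042's `evalAt_autProj_rho_eq_thetaMod_inv`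
  at `(RD, ιX) := (C.rigidData μ hC hS h15 L, id)`;
* **`exists_coeffMap_ofThetaSettingDataQ`** — `(e, he, hPproj)` in the binder types of abc-iut-L2-t4's Prop. 5.5 / the K4 capstone
  (`cyclotomicRigidity_ofConnectedTemperoidData_of_pullRoot` p430047, `…_capstone` p437254) at `𝔉 := ofThetaSettingDataQ …`
  (`e : RD.mu → 𝔉.lDeltaModN 𝔉.BN`, `k : RD.PiYdd`, `RD := C.rigidData μ hC hS h15 L`), for any `P : ThetaSubquotientProj 𝔉` PINNED at `B_N^bs`
  to print's `Aut`-subquotient by two equations (`hPpre` as in abc-iut-w4-d042's `Sec5Prop55OfConnectedTemperoidLevelN`, and `hPproj` on `proj`).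

WHY PINNED AND NOT PACKAGED (honest): the frozen `ThetaSubquotientProj 𝔉` asks `proj_surjective` at EVERY object; print's `Aut`-projection is onto at
Galois objects (abc-iut-L2-t9 p436169) — GAP-LEDGER G-w4d042g3-1 / v-next B1; so no `P` term is constructed here.  Nothing asserts that [EtTh]'s
data exist for an actual curve (`tf` abstract); [EtTh] is refereed; no side taken on [IUTchIII] Cor. 3.12; typed ≠ proved.
-/

noncomputable section

namespace Literature.AnabelianGeometry.EtaleTheta

open CategoryTheory Opposite FrobenioidCyclotomicRigidity Literature.AlgebraicGeometry.Frobenioids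
  Literature.AnabelianGeometry.SemiGraphs Literature.AnabelianGeometry.SemiGraphs.GaloisObjects ThetaSubquotient
open Literature.AlgebraicGeometry.Frobenioids.QuasiTemperoid (stabilizerSubgroup)
-- Mathlib's (deliberately scoped) instance `[Group G] [IsMulCommutative G] : CommGroup G`: `l·Δ_Θ` is a `CommGroup` with the SAME
-- operations as the subgroup (the device of abc-iut-L2-t9's pin `ThetaSubquotientOfThetaSetting.lean`).
open scoped IsMulCommutative

universe u v w' u₁ u₂ v₀

/-! ### 0. Generic layer (light context): `n`-th powers in `(l·Δ_Θ)_E` are detected at one point; the coefficient map of a `ρ` -/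

namespace ThetaSubquotient

variable {G : Type u} [Group G] [TopologicalSpace G] {Q : Type v} [Group Q] {Λ : Type w'} [CommGroup Λ]
  (q : G →* Q) (ι : Λ →* Q) [ι.range.Normal]

section Pow

variable {E : BTemp G} (hE : IsConnectedObj E) (x : E.obj.V)
include hE

/-- On a connected object `E`, an element of `(l·Δ_Θ)_E` whose value at some point `x` is (the class of) an `n`-th power is itself an
`n`-th power — `evalAt x : (l·Δ_Θ)_E ⥲ Λ/J(Stab x)` is a bijection (abc-iut-L2-t9's `evalEquiv`).  [cite: MochizukiEtTh2009, §5 p.327 (PDF p.101)] -/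
theorem mem_range_powMonoidHom_of_evalAt_eq (n : ℕ) (c : LDelta q ι E) (y : Λ)
    (h : evalAt q ι E x c = QuotientGroup.mk (y ^ n)) :
    c ∈ (powMonoidHom n : LDelta q ι E →* LDelta q ι E).range := by
  obtain ⟨d, hd⟩ := evalAt_surjective q ι hE x (QuotientGroup.mk y)
  refine ⟨d, evalAt_injective q ι hE x ?_⟩
  rw [powMonoidHom_apply, map_pow, hd, h, QuotientGroup.mk_pow]

/-- **Mod `n`-th powers, an element of `(l·Δ_Θ)_E` is determined by its value at one point READ THROUGH a homomorphism `red : Λ → M`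
whose kernel consists of `n`-th powers** ("`l·Δ_Θ ↠ (l·Δ_Θ) ⊗ ℤ/Nℤ ≅ μ_N`", p.46): if `evalAt x cᵢ = [bᵢ⁻¹]` (`i = 1, 2`) and
`red b₁ = red b₂`, then `[c₁] = [c₂]` in `(l·Δ_Θ)_E ⊗ ℤ/nℤ`.  [cite: MochizukiEtTh2009, §2 p.272 (PDF p.46); §5 p.327 (PDF p.101)] -/
theorem mk_modPow_eq_of_evalAt_eq_inv (n : ℕ) {M : Type u₁} [Group M] (red : Λ →* M)
    (hker : ∀ z : Λ, red z = 1 → ∃ y : Λ, z = y ^ n) (c₁ c₂ : LDelta q ι E) (b₁ b₂ : Λ)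
    (h₁ : evalAt q ι E x c₁ = QuotientGroup.mk b₁⁻¹) (h₂ : evalAt q ι E x c₂ = QuotientGroup.mk b₂⁻¹) (hθ : red b₁ = red b₂) :
    (QuotientGroup.mk c₁ : LDelta q ι E ⧸ (powMonoidHom n : LDelta q ι E →* LDelta q ι E).range) = QuotientGroup.mk c₂ := by
  obtain ⟨y, hy⟩ := hker (b₁ * b₂⁻¹) (by rw [map_mul, map_inv, hθ, mul_inv_cancel])
  refine QuotientGroup.eq.2 (mem_range_powMonoidHom_of_evalAt_eq q ι hE x n _ y ?_)
  simp only [map_mul, map_inv, h₁, h₂, ← hy, QuotientGroup.mk_mul, QuotientGroup.mk_inv, inv_inv]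

end Pow

section Rho

variable {E : BTemp G} (x : E.obj.V) {Γ : Type u₁} [Group Γ] (φ : Γ →* G) (ρ : Γ →* Aut E)
  (hρ : ∀ k : Γ, ((ρ k).hom.hom.hom x : E.obj.V) = E.obj.ρ (φ k)⁻¹ x) (hE : IsConnectedObj E)
  (Γ₀ : Subgroup Γ) (lg : Γ₀ → Λ) (hlg : ∀ k : Γ₀, ι (lg k) = q (φ k)) (hL : Function.Surjective lg)
include hρ hE hlg hL

/-- For `ρ : Γ → Aut_D(E)` acting at a base point `x` of the connected `E` by `(ρ k)(x) = (φ k)⁻¹·x` (abc-iut-w4-d042's shape, [SemiAnbd]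
Rmk. 3.1.3) and a subgroup `Γ₀ ≤ Γ` with a "logarithm" `lg : Γ₀ → Λ`, `ι ∘ lg = q ∘ φ`, ONTO `Λ` (print: `l·Δ_Θ ⊆ q(Π^tp_X̲̲)`): **EVERY element
of `(l·Δ_Θ)_E` is `autProj (ρ k)` for some `k ∈ Γ₀`** — read the element at `x` as `[a]`, pick `k` with `lg k = a⁻¹`, compare values at `x`
(`evalAt` injective, `evalAt_autProj_rho`).  [cite: MochizukiEtTh2009, Prop 5.5 proof p.327–328 (PDF pp.101–102)] -/
theorem exists_autProj_rho_eq_of_lg (c : LDelta q ι E) :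
    ∃ (k : Γ) (_ : k ∈ Γ₀) (hm : ρ k ∈ autPre q ι E), autProj q ι E ⟨ρ k, hm⟩ = c := by
  obtain ⟨a, ha⟩ := QuotientGroup.mk_surjective (evalAt q ι E x c)
  obtain ⟨k, hk⟩ := hL a⁻¹
  have hk' : q (φ k) ∈ ι.range := ⟨lg k, hlg k⟩
  have hm := mem_autPre_of_rho_apply_base q ι x φ ρ hρ hE k hk'
  refine ⟨k, k.2, hm, evalAt_injective q ι hE x ?_⟩
  rw [evalAt_autProj_rho q ι x φ ρ hρ k a (by rw [map_inv, ← hlg, hk, map_inv, inv_inv]) hm, ha]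

/-- **The coefficient map `(e, he, hPproj)` of Prop. 5.5, generically.**  With `ρ, Γ₀, lg` as above and a homomorphism `red : Λ → M` with
`Ker(red) ⊆ Λ^n` such that `red ∘ lg : Γ₀ → M` is onto (print: `thetaMod : l·Δ_Θ ↠ μ_N`), there is a SURJECTIVE `e : M → (l·Δ_Θ)_E ⊗ ℤ/nℤ`
with `mk (autProj (ρ k)) = e (red (lg k))` for every `k ∈ Γ₀`: `e m :=` the class of `autProj (ρ k_m)` for any `k_m` with `red (lg k_m) = m`
(well defined by `mk_modPow_eq_of_evalAt_eq_inv`, onto by `exists_autProj_rho_eq_of_lg`).  [cite: MochizukiEtTh2009, Prop 5.5 p.327–328 (PDF pp.101–102)] -/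
theorem exists_coeffMap_of_lg (n : ℕ) {M : Type u₂} [Group M] (red : Λ →* M) (hker : ∀ z : Λ, red z = 1 → ∃ y : Λ, z = y ^ n)
    (hsurj : ∀ m : M, ∃ k : Γ₀, red (lg k) = m) :
    ∃ ec : M → LDelta q ι E ⧸ (powMonoidHom n : LDelta q ι E →* LDelta q ι E).range,
      Function.Surjective ec ∧
        ∀ (k : Γ) (hk : k ∈ Γ₀) (hm : ρ k ∈ autPre q ι E), QuotientGroup.mk (autProj q ι E ⟨ρ k, hm⟩) = ec (red (lg ⟨k, hk⟩)) := by
  choose g hg using hsurj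
  have hpre : ∀ k : Γ₀, ρ k ∈ autPre q ι E := fun k =>
    mem_autPre_of_rho_apply_base q ι x φ ρ hρ hE k ⟨lg k, hlg k⟩
  have hval : ∀ k : Γ₀, evalAt q ι E x (autProj q ι E ⟨ρ k, hpre k⟩) = QuotientGroup.mk (lg k)⁻¹ := fun k =>
    evalAt_autProj_rho q ι x φ ρ hρ k _ (by rw [map_inv, hlg, map_inv]) (hpre k)
  refine ⟨fun m => QuotientGroup.mk (autProj q ι E ⟨ρ (g m), hpre (g m)⟩), ?_, ?_⟩
  · intro z
    obtain ⟨c, rfl⟩ := QuotientGroup.mk_surjective z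
    obtain ⟨k, hk, hm, hc⟩ := exists_autProj_rho_eq_of_lg q ι x φ ρ hρ hE Γ₀ lg hlg hL c
    refine ⟨red (lg ⟨k, hk⟩), ?_⟩
    rw [← hc]
    exact mk_modPow_eq_of_evalAt_eq_inv q ι hE x n red hker _ _ (lg (g _)) (lg ⟨k, hk⟩) (hval _) (hval ⟨k, hk⟩) (hg _)
  · intro k hk hm
    exact (mk_modPow_eq_of_evalAt_eq_inv q ι hE x n red hker _ _ (lg (g _)) (lg ⟨k, hk⟩) (hval _) (hval ⟨k, hk⟩) (hg _)).symm

end Rho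

end ThetaSubquotient

/-! ### 0'. `toLDelta : q⁻¹(l·Δ_Θ) ∩ Π^tp_X̲̲ → l·Δ_Θ` is onto (the double underline situation `l·Δ_Θ ⊆ (Π^tp_X̲̲)^Θ`) -/

namespace ThetaSetting.EtaleThetaData.DoubleUnderline

variable {p : ℕ} [Fact p.Prime] {D : ThetaSetting p} {E : D.EtaleThetaData} {l : ℕ} (C : E.DoubleUnderline l)

/-- **`toLDelta` is onto `l·Δ_Θ`**: `l·Δ_Θ ⊆ q(Π^tp_X̲̲)` (abc-iut-L2-t9's `range_ιTheta_le_range_qSub_Huu` / `ιTheta_mem_range`, p436169/p437771).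
[cite: MochizukiEtTh2009, Prop 2.12 (i) p.271 (PDF p.45); §5 p.327 (PDF p.101)] -/
theorem toLDelta_surjective : Function.Surjective C.toLDelta := by
  intro a
  obtain ⟨k, hk⟩ := C.ιTheta_mem_range (l := l) a
  have hk' : k ∈ (D.lDeltaTheta l).comap (D.toTheta.comp C.Huu.subtype) := by
    rw [Subgroup.mem_comap]
    change ThetaSubquotient.qSub D C.Huu k ∈ D.lDeltaTheta l
    rw [hk]
    exact a.2
  exact ⟨⟨k, hk'⟩, Subtype.ext hk⟩

end ThetaSetting.EtaleThetaData.DoubleUnderline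

namespace ThetaFrobenioid

/-! ### 1. hP at the base point of `B_N^bs`, in print's currency and read at level `N` -/

section Setting

variable {p : ℕ} [Fact p.Prime] {D : ThetaSetting p} {E : D.EtaleThetaData} {l : ℕ} {C : E.DoubleUnderline l}
  {e : D.toTemperedCurve.GroupLevelData} {N : ℕ+} (μ : D.CyclotomeMod l N) (hC : D.Compat) (hS : D.Sec2Hyps)
  {D₀ : Type} [Category.{v₀} D₀] {V : FrdIMonoidStub.{0}} {T₀ : RealifiedDivisorMonoids (D₀ := D₀) V}
  {VD : FrdICatStub.{1, 0, 0} (ConnectedPart (BTemp (C.temperedArithmeticGroup e).Pi))}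
  {tf : TemperedFrobenioid T₀ (ConnectedPart (BTemp (C.temperedArithmeticGroup e).Pi)) VD} {hZ : tf.monoidType = MonoidType.Z}
  {hP : ∀ A : (ConnectedPart (BTemp (C.temperedArithmeticGroup e).Pi))ᵒᵖ, IsPerfect (tf.Φ.carrier A)}
  {NH : Subgroup (Field.absoluteGaloisGroup D.K) → tf.category → ℕ+ → Prop} {A₀ : tf.category}
  {hA₀ : PreFrobenioid.IsFrobeniusTrivial tf.toElem A₀} {hA₀' : SemiGraphs.IsGaloisObj A₀.base.obj}
  {pullFrac : ∀ {A A' : (BiKummerSetting.mkOfConnectedTemperoid (C.temperedArithmeticGroup e) tf hZ hP NH A₀ hA₀ hA₀').C} (_ : A' ⟶ A),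
    (BiKummerSetting.mkOfConnectedTemperoid (C.temperedArithmeticGroup e) tf hZ hP NH A₀ hA₀ hA₀').biratUnits A →
      (BiKummerSetting.mkOfConnectedTemperoid (C.temperedArithmeticGroup e) tf hZ hP NH A₀ hA₀ hA₀').biratUnits A'}
  {θ : (BiKummerSetting.mkOfConnectedTemperoid (C.temperedArithmeticGroup e) tf hZ hP NH A₀ hA₀ hA₀').biratUnits
    (BiKummerSetting.mkOfConnectedTemperoid (C.temperedArithmeticGroup e) tf hZ hP NH A₀ hA₀ hA₀').Aodot}
  {Bl : (BiKummerSetting.mkOfConnectedTemperoid (C.temperedArithmeticGroup e) tf hZ hP NH A₀ hA₀ hA₀').C}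
  {Pl : (BiKummerSetting.mkOfConnectedTemperoid (C.temperedArithmeticGroup e) tf hZ hP NH A₀ hA₀ hA₀').FractionPair θ Bl}
  {Rl : (BiKummerSetting.mkOfConnectedTemperoid (C.temperedArithmeticGroup e) tf hZ hP NH A₀ hA₀ hA₀').NthRoot θ Pl C.lPNat pullFrac}
  (R : (BiKummerSetting.mkOfConnectedTemperoid (C.temperedArithmeticGroup e) tf hZ hP NH A₀ hA₀ hA₀').NthRoot Rl.root Rl.pair N pullFrac)

/-- **hP at the base point, PRINT'S CURRENCY.**  For `k ∈ Π^tp_X̲̲` with `q(k) ∈ l·Δ_Θ` (i.e. `k ∈ RD.lDeltaTheta`): `autProj (ρ k)`, print's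
projection of `ρ k ∈ P_{B_N^bs}` to `(l·Δ_Θ)_{B_N^bs}(q, ι)`, evaluates at the base point `x = (s^⊓_N)^bs(x_{A_N})` to the class of `q(k)⁻¹ ∈ l·Δ_Θ`
(abc-iut-L2-t8's `toLDelta k`, inverted: `ρ(g)(x) = g⁻¹·x`).  [cite: MochizukiEtTh2009, §5 p.327 (PDF p.101); Prop 2.12 (i) p.271 (PDF p.45)] -/
theorem evalAt_autProj_rho_ofThetaSetting (k : C.Huu) (hk : k ∈ (D.lDeltaTheta l).comap (D.toTheta.comp C.Huu.subtype))
    (hm : ((Functor.mapAut R.BN.base (connectedObjects (BTemp (C.temperedArithmeticGroup e).Pi)).ι).comp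
        (rhoOfBiKummerData (T := C.thetaEnvData μ hC hS) R (ContinuousMulEquiv.refl _))) k ∈
      autPre (qSub D C.Huu) (ιTheta D l) R.BN.base.obj) :
    evalAt (qSub D C.Huu) (ιTheta D l) R.BN.base.obj
        ((BiKummerSetting.NthRoot.baseIso _ R).hom.hom.hom.hom
          (galoisBase (C.temperedArithmeticGroup e).isTempered R.AN.base.obj R.αData.isGalois))
        (autProj (qSub D C.Huu) (ιTheta D l) R.BN.base.obj ⟨_, hm⟩) =
      QuotientGroup.mk (C.toLDelta ⟨k, hk⟩)⁻¹ :=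
  evalAt_autProj_rhoOfBiKummerData (T := C.thetaEnvData μ hC hS) R (ContinuousMulEquiv.refl _) (qSub D C.Huu) (ιTheta D l)
    k _ (by rw [map_inv, map_inv]; rfl) hm

/-- The same with the membership clause `toTheta k ∈ l·Δ_Θ` (abc-iut-L2-t4's spelling in `Sec5OfThetaSettingQ`; the two clauses agree by
`Iff.rfl`, `toTheta_mem_lDeltaTheta_iff_mem_rigidData`): the value is the class of `(toTheta k)⁻¹`.
[cite: MochizukiEtTh2009, §5 p.327 (PDF p.101)] -/
theorem evalAt_autProj_rho_ofThetaSetting_of_toTheta_mem (k : C.Huu) (hk : D.toTheta (k : D.PiTemp) ∈ D.lDeltaTheta l)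
    (hm : ((Functor.mapAut R.BN.base (connectedObjects (BTemp (C.temperedArithmeticGroup e).Pi)).ι).comp
        (rhoOfBiKummerData (T := C.thetaEnvData μ hC hS) R (ContinuousMulEquiv.refl _))) k ∈
      autPre (qSub D C.Huu) (ιTheta D l) R.BN.base.obj) :
    evalAt (qSub D C.Huu) (ιTheta D l) R.BN.base.obj
        ((BiKummerSetting.NthRoot.baseIso _ R).hom.hom.hom.hom
          (galoisBase (C.temperedArithmeticGroup e).isTempered R.AN.base.obj R.αData.isGalois))
        (autProj (qSub D C.Huu) (ιTheta D l) R.BN.base.obj ⟨_, hm⟩) =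
      QuotientGroup.mk (⟨D.toTheta (k : D.PiTemp), hk⟩ : ↥(D.lDeltaTheta l))⁻¹ :=
  evalAt_autProj_rho_ofThetaSetting μ hC hS R k hk hm

/-- **hpre in print's currency** (abc-iut-w4-d042's `mapAut_rho_mem_autPre_of_mem_range` at the Setting; cf. abc-iut-L2-t4's
`mapAut_rho_mem_autPre_ofThetaSetting`): `k ∈ RD.lDeltaTheta ⇒ ρ k ∈ P_{B_N^bs} = autPre q ι`.  [cite: MochizukiEtTh2009, §5 p.327 (PDF p.101)] -/
theorem mapAut_rho_mem_autPre_ofThetaSetting_of_mem (k : C.Huu) (hk : k ∈ (D.lDeltaTheta l).comap (D.toTheta.comp C.Huu.subtype)) :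
    ((Functor.mapAut R.BN.base (connectedObjects (BTemp (C.temperedArithmeticGroup e).Pi)).ι).comp
        (rhoOfBiKummerData (T := C.thetaEnvData μ hC hS) R (ContinuousMulEquiv.refl _))) k ∈
      autPre (qSub D C.Huu) (ιTheta D l) R.BN.base.obj :=
  mapAut_rho_mem_autPre_of_mem_range (T := C.thetaEnvData μ hC hS) R (ContinuousMulEquiv.refl _) (qSub D C.Huu) (ιTheta D l) k
    ⟨C.toLDelta ⟨k, hk⟩, rfl⟩

/-- **MOD `N`, `autProj (ρ k)` DEPENDS ONLY ON `thetaMod k ∈ μ_N`**: if `thetaMod k₁ = thetaMod k₂` then `q(k₁)·q(k₂)⁻¹` is an `N`-th power in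
`l·Δ_Θ` (`Ker(red) = N`-th powers, `μ.red_ker`), so `autProj (ρ k₁)` and `autProj (ρ k₂)` — whose values at the base point are `[q(kᵢ)⁻¹]` — differ by
an `N`-th power of `(l·Δ_Θ)_{B_N^bs}` (`mem_range_powMonoidHom_of_evalAt_eq`).  Here `thetaMod = red ∘ toLDelta` is abc-iut-L2-t8's `(C.rigidData …).thetaMod`.
[cite: MochizukiEtTh2009, §2 p.272 (PDF p.46); §5 p.327 (PDF p.101)] -/
theorem autProj_rho_modN_eq_of_thetaMod_eq (h15 : ThetaSetting.Prop15iii E hC) (L : C.CuspLabels) (k₁ k₂ : C.Huu)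
    (hk₁ : k₁ ∈ (C.rigidData μ hC hS h15 L).lDeltaTheta) (hk₂ : k₂ ∈ (C.rigidData μ hC hS h15 L).lDeltaTheta)
    (hm₁ : ((Functor.mapAut R.BN.base (connectedObjects (BTemp (C.temperedArithmeticGroup e).Pi)).ι).comp
        (rhoOfBiKummerData (T := C.thetaEnvData μ hC hS) R (ContinuousMulEquiv.refl _))) k₁ ∈
      autPre (qSub D C.Huu) (ιTheta D l) R.BN.base.obj)
    (hm₂ : ((Functor.mapAut R.BN.base (connectedObjects (BTemp (C.temperedArithmeticGroup e).Pi)).ι).comp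
        (rhoOfBiKummerData (T := C.thetaEnvData μ hC hS) R (ContinuousMulEquiv.refl _))) k₂ ∈
      autPre (qSub D C.Huu) (ιTheta D l) R.BN.base.obj)
    (hθ : (C.rigidData μ hC hS h15 L).thetaMod ⟨k₁, hk₁⟩ = (C.rigidData μ hC hS h15 L).thetaMod ⟨k₂, hk₂⟩) :
    (QuotientGroup.mk (autProj (qSub D C.Huu) (ιTheta D l) R.BN.base.obj ⟨_, hm₁⟩) :
        LDelta (qSub D C.Huu) (ιTheta D l) R.BN.base.obj ⧸
          (powMonoidHom (N : ℕ) : LDelta (qSub D C.Huu) (ιTheta D l) R.BN.base.obj →*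
            LDelta (qSub D C.Huu) (ιTheta D l) R.BN.base.obj).range) =
      QuotientGroup.mk (autProj (qSub D C.Huu) (ιTheta D l) R.BN.base.obj ⟨_, hm₂⟩) := by
  -- one `exact` of the generic `mk_modPow_eq_of_evalAt_eq_inv` (tactic hygiene for this deep context: no `rw`/`obtain … := <term>` on
  -- goals mentioning the §5 data — their motive type-checks exceed the default heartbeat budget)
  have e₁ := evalAt_autProj_rho_ofThetaSetting μ hC hS R k₁ hk₁ hm₁
  have e₂ := evalAt_autProj_rho_ofThetaSetting μ hC hS R k₂ hk₂ hm₂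
  exact mk_modPow_eq_of_evalAt_eq_inv (qSub D C.Huu) (ιTheta D l) R.BN.base.property
    ((BiKummerSetting.NthRoot.baseIso _ R).hom.hom.hom.hom
      (galoisBase (C.temperedArithmeticGroup e).isTempered R.AN.base.obj R.αData.isGalois)) (N : ℕ) μ.red
    (fun z hz => (μ.red_ker z).1 hz) _ _ _ _ e₁ e₂ hθ

/-- **EVERY element of `(l·Δ_Θ)_{B_N^bs}(q, ι)` is `autProj (ρ k)` for some `k ∈ Π^tp_X̲̲` with `q(k) ∈ l·Δ_Θ`**: read the element at the base point as
`[a]`, `a ∈ l·Δ_Θ` (`evalAt` onto), pick `k ∈ Π^tp_X̲̲` with `q(k) = a⁻¹` (`l·Δ_Θ ⊆ q(Π^tp_X̲̲)`, the double underline situation — abc-iut-L2-t9's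
`range_ιTheta_le_range_qSub_Huu`), then `ρ k ∈ P_{B_N^bs}` (hpre) and `autProj (ρ k)` has the same value at `x` (`evalAt` injective).
[cite: MochizukiEtTh2009, Prop 5.5 proof p.327–328 (PDF pp.101–102)] -/
theorem exists_autProj_rho_eq_ofThetaSetting (c : LDelta (qSub D C.Huu) (ιTheta D l) R.BN.base.obj) :
    ∃ (k : C.Huu) (_ : k ∈ (D.lDeltaTheta l).comap (D.toTheta.comp C.Huu.subtype))
      (hm : ((Functor.mapAut R.BN.base (connectedObjects (BTemp (C.temperedArithmeticGroup e).Pi)).ι).comp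
          (rhoOfBiKummerData (T := C.thetaEnvData μ hC hS) R (ContinuousMulEquiv.refl _))) k ∈
        autPre (qSub D C.Huu) (ιTheta D l) R.BN.base.obj),
      autProj (qSub D C.Huu) (ιTheta D l) R.BN.base.obj ⟨_, hm⟩ = c :=
  exists_autProj_rho_eq_of_lg (qSub D C.Huu) (ιTheta D l)
    ((BiKummerSetting.NthRoot.baseIso _ R).hom.hom.hom.hom
      (galoisBase (C.temperedArithmeticGroup e).isTempered R.AN.base.obj R.αData.isGalois))
    (ContinuousMulEquiv.refl _).toMonoidHom _ (rhoOfBiKummerData_obj_apply_base (T := C.thetaEnvData μ hC hS) R (ContinuousMulEquiv.refl _))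
    R.BN.base.property ((D.lDeltaTheta l).comap (D.toTheta.comp C.Huu.subtype)) C.toLDelta (fun _ => rfl) C.toLDelta_surjective c

/-- **`(e, he, hPproj)` IN PRINT'S-`Q` CURRENCY (cheap spelling, everything read in `B^temp(Π^tp_X̲̲)` through `mapAut`).**  There is a SURJECTIVE
`e : μ_N → (l·Δ_Θ)_{B_N^bs}(q, ι) ⊗ ℤ/Nℤ` with `mk (autProj (ρ k)) = e (thetaMod k)` for every `k ∈ Π^tp_X̲̲` with `q(k) ∈ l·Δ_Θ`: `e m` is the class
of `autProj (ρ k_m)` for any `k_m` with `thetaMod k_m = m` (`thetaMod_surjective`; well defined by `autProj_rho_modN_eq_of_thetaMod_eq`), onto by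
`exists_autProj_rho_eq_ofThetaSetting` — "`l·Δ_Θ ↠ (l·Δ_Θ) ⊗ ℤ/Nℤ ≅ μ_N`" (p.46) read on print's `Aut`-subquotient at `B_N^bs`.
[cite: MochizukiEtTh2009, Prop 5.5 p.327–328 (PDF pp.101–102); §2 p.272 (PDF p.46)] -/
theorem exists_coeffMap_autProj_ofThetaSetting (h15 : ThetaSetting.Prop15iii E hC) (L : C.CuspLabels) :
    ∃ ec : (C.rigidData μ hC hS h15 L).mu →
        LDelta (qSub D C.Huu) (ιTheta D l) R.BN.base.obj ⧸
          (powMonoidHom (N : ℕ) : LDelta (qSub D C.Huu) (ιTheta D l) R.BN.base.obj →*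
            LDelta (qSub D C.Huu) (ιTheta D l) R.BN.base.obj).range,
      Function.Surjective ec ∧
        ∀ (k : C.Huu) (hk : k ∈ (C.rigidData μ hC hS h15 L).lDeltaTheta)
          (hm : ((Functor.mapAut R.BN.base (connectedObjects (BTemp (C.temperedArithmeticGroup e).Pi)).ι).comp
              (rhoOfBiKummerData (T := C.thetaEnvData μ hC hS) R (ContinuousMulEquiv.refl _))) k ∈
            autPre (qSub D C.Huu) (ιTheta D l) R.BN.base.obj),
          QuotientGroup.mk (autProj (qSub D C.Huu) (ιTheta D l) R.BN.base.obj ⟨_, hm⟩) = ec ((C.rigidData μ hC hS h15 L).thetaMod ⟨k, hk⟩) :=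
  exists_coeffMap_of_lg (qSub D C.Huu) (ιTheta D l)
    ((BiKummerSetting.NthRoot.baseIso _ R).hom.hom.hom.hom
      (galoisBase (C.temperedArithmeticGroup e).isTempered R.AN.base.obj R.αData.isGalois))
    (ContinuousMulEquiv.refl _).toMonoidHom _ (rhoOfBiKummerData_obj_apply_base (T := C.thetaEnvData μ hC hS) R (ContinuousMulEquiv.refl _))
    R.BN.base.property ((D.lDeltaTheta l).comap (D.toTheta.comp C.Huu.subtype)) C.toLDelta (fun _ => rfl) C.toLDelta_surjective
    (N : ℕ) μ.red (fun z hz => (μ.red_ker z).1 hz) (C.rigidData μ hC hS h15 L).thetaMod_surjective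

/-- **`settingToLevelN (autProj_{(q,ι)} (ρ k)) = autProj_{(q_N,ι_N)} (ρ k)`** — print's projection of `ρ k`, pushed along abc-iut-L2-t9's comparison
`(l·Δ_Θ)_E(q, ι) → (l·Δ_Θ ⊗ ℤ/Nℤ)_E(q_N, ι_N)` (p437963), IS abc-iut-w4-d042's level-`N` projection of `ρ k` (its `Aut`-subquotient domain being
the same subgroup, `autPre_setting_eq_levelN`).  [cite: MochizukiEtTh2009, §5 p.327 (PDF p.101)] -/
theorem settingToLevelN_autProj_rho (h15 : ThetaSetting.Prop15iii E hC) (L : C.CuspLabels) (k : C.Huu)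
    (hm : ((Functor.mapAut R.BN.base (connectedObjects (BTemp (C.temperedArithmeticGroup e).Pi)).ι).comp
        (rhoOfBiKummerData (T := C.thetaEnvData μ hC hS) R (ContinuousMulEquiv.refl _))) k ∈
      autPre (qSub D C.Huu) (ιTheta D l) R.BN.base.obj) :
    haveI := (C.rigidData μ hC hS h15 L).iotaN_range_normal
    C.settingToLevelN μ hC hS h15 L R.BN.base.obj (autProj (qSub D C.Huu) (ιTheta D l) R.BN.base.obj ⟨_, hm⟩) =
      autProj ((C.rigidData μ hC hS h15 L).qN (ContinuousMulEquiv.refl _)) (C.rigidData μ hC hS h15 L).iotaN R.BN.base.obj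
        ⟨_, C.autPre_setting_le_levelN μ hC hS h15 L R.BN.base.obj hm⟩ :=
  C.settingToLevelN_autProj μ hC hS h15 L R.BN.base.obj R.BN.base.property ⟨_, hm⟩

/-- **hP read at LEVEL `N` through the comparison** ("thetaMod-vs-evalEquiv", L2-lead R222): for `k ∈ Π^tp_X̲̲` with `q(k) ∈ l·Δ_Θ`,
`evalAt_N x (settingToLevelN (autProj (ρ k))) = [(thetaMod k)⁻¹] ∈ μ_N / J_N(Stab x)` — abc-iut-w4-d042's `evalAt_autProj_rho_eq_thetaMod_inv`
(p431034) at `(RD, ιX) := (C.rigidData μ hC hS h15 L, id)` after `settingToLevelN_autProj_rho`.  So the LEVEL-`N` coefficient map of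
abc-iut-w5-d020's discharge and the print's-`Q` one of this file correspond under `settingToLevelN`.
[cite: MochizukiEtTh2009, §5 p.327 (PDF p.101); §2 p.272 (PDF p.46)] -/
theorem evalAt_settingToLevelN_autProj_rho (h15 : ThetaSetting.Prop15iii E hC) (L : C.CuspLabels) (k : C.Huu)
    (hk : k ∈ (C.rigidData μ hC hS h15 L).lDeltaTheta)
    (hm : ((Functor.mapAut R.BN.base (connectedObjects (BTemp (C.temperedArithmeticGroup e).Pi)).ι).comp
        (rhoOfBiKummerData (T := C.thetaEnvData μ hC hS) R (ContinuousMulEquiv.refl _))) k ∈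
      autPre (qSub D C.Huu) (ιTheta D l) R.BN.base.obj) :
    haveI := (C.rigidData μ hC hS h15 L).iotaN_range_normal
    evalAt ((C.rigidData μ hC hS h15 L).qN (ContinuousMulEquiv.refl _)) (C.rigidData μ hC hS h15 L).iotaN R.BN.base.obj
        ((BiKummerSetting.NthRoot.baseIso _ R).hom.hom.hom.hom
          (galoisBase (C.temperedArithmeticGroup e).isTempered R.AN.base.obj R.αData.isGalois))
        (C.settingToLevelN μ hC hS h15 L R.BN.base.obj (autProj (qSub D C.Huu) (ιTheta D l) R.BN.base.obj ⟨_, hm⟩)) =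
      QuotientGroup.mk ((C.rigidData μ hC hS h15 L).thetaMod ⟨k, hk⟩)⁻¹ := by
  haveI := (C.rigidData μ hC hS h15 L).iotaN_range_normal
  have h1 := settingToLevelN_autProj_rho μ hC hS R h15 L k hm
  have h2 := evalAt_autProj_rho_eq_thetaMod_inv (RD := C.rigidData μ hC hS h15 L) R (ContinuousMulEquiv.refl _) k hk
    (C.autPre_setting_le_levelN μ hC hS h15 L R.BN.base.obj hm)
  exact (congrArg (evalAt ((C.rigidData μ hC hS h15 L).qN (ContinuousMulEquiv.refl _)) (C.rigidData μ hC hS h15 L).iotaN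
    R.BN.base.obj ((BiKummerSetting.NthRoot.baseIso _ R).hom.hom.hom.hom
      (galoisBase (C.temperedArithmeticGroup e).isTempered R.AN.base.obj R.αData.isGalois))) h1).trans h2

/-! ### 2. `(e, he, hPproj)` in the binder types of Prop. 5.5 / the K4 capstone at `𝔉 := ofThetaSettingDataQ`, `P` pinned at `B_N^bs` -/

variable (h : ModelFrobenioid.Hypotheses tf.divisorMonoid tf.ratFnFunctor) (K' : Type) [Field K']
  (constEmb : K'ˣ →* tf.biratUnitsModel R.BN) (constEmb_injective : Function.Injective constEmb)
  (hinvc : ∀ g : Aut R.AN.base,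
    pull tf.divisorMonoid g.hom (ModelFrobenioid.div R.pair.num) = ModelFrobenioid.div R.pair.num)
  (hinvp : ∀ y : (C.thetaEnvData μ hC hS).PiX, y ∈ (C.thetaEnvData μ hC hS).PiYdd →
    pull tf.divisorMonoid ((BiKummerSetting.mkOfConnectedTemperoid (C.temperedArithmeticGroup e) tf hZ hP NH A₀ hA₀ hA₀').galoisSurj
      R.AN.base R.αData.isGalois ((ContinuousMulEquiv.refl _) y)).hom (ModelFrobenioid.div R.pair.den) = ModelFrobenioid.div R.pair.den)

/-- **The binders `(e, he, hPproj)` of [EtTh] Prop. 5.5 DISCHARGED at the §5 data OF THE SETTING with print's `Q`** (abc-iut-L2-t4's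
`𝔉 := ofThetaSettingDataQ μ hC hS h R K' …`, `Q = ofSettingSub D l C.Huu`), in EXACTLY the binder types of
`cyclotomicRigidity_ofConnectedTemperoidData_of_pullRoot` (p430047) / `exists_rigidityFamily_unique_preserved_ofConnectedTemperoidData_capstone`
(p437254) read at `(X, RD, ιX) := (Π^tp_X̲̲, C.rigidData μ hC hS h15 L, id)`: for ANY `P : ThetaSubquotientProj 𝔉` which AT `B_N^bs` is print's
`Aut`-subquotient — `hPpre : P.pre B_N^bs = (autPre q ι).comap mapAut` (abc-iut-w4-d042's pin) and `hPproj : P.proj B_N^bs = autProj q ι ∘ mapAut` —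
there is a SURJECTIVE `e : μ_N → (l·Δ_Θ)_{B_N} ⊗ ℤ/Nℤ` with `mk (P.proj (ρ k)) = e (thetaMod k)` for every `k ∈ Π^tp_Ÿ̲̲ ∩ (l·Δ_Θ)`.
(No `P` TERM is built: `proj_surjective` at every object is GAP G-w4d042g3-1.)  [cite: MochizukiEtTh2009, Prop 5.5 p.327–328 (PDF pp.101–102)] -/
theorem exists_coeffMap_ofThetaSettingDataQ (h15 : ThetaSetting.Prop15iii E hC) (L : C.CuspLabels)
    (P : ThetaSubquotientProj (ofThetaSettingDataQ μ hC hS h R K' constEmb constEmb_injective hinvc hinvp))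
    (hPpre : P.pre R.BN.base = (autPre (qSub D C.Huu) (ιTheta D l) R.BN.base.obj).comap
        (Functor.mapAut R.BN.base (connectedObjects (BTemp (C.temperedArithmeticGroup e).Pi)).ι))
    (hPproj : ∀ (σ : Aut R.BN.base) (h₁ : σ ∈ P.pre R.BN.base)
        (h₂ : (Functor.mapAut R.BN.base (connectedObjects (BTemp (C.temperedArithmeticGroup e).Pi)).ι) σ ∈
          autPre (qSub D C.Huu) (ιTheta D l) R.BN.base.obj),
        P.proj R.BN.base ⟨σ, h₁⟩ = autProj (qSub D C.Huu) (ιTheta D l) R.BN.base.obj ⟨_, h₂⟩) :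
    ∃ ec : (C.rigidData μ hC hS h15 L).mu →
        (ofThetaSettingDataQ μ hC hS h R K' constEmb constEmb_injective hinvc hinvp).lDeltaModN
          (ofThetaSettingDataQ μ hC hS h R K' constEmb constEmb_injective hinvc hinvp).BN,
      Function.Surjective ec ∧
        ∀ (k : (C.rigidData μ hC hS h15 L).PiYdd) (hk : (k : (C.rigidData μ hC hS h15 L).PiX) ∈ (C.rigidData μ hC hS h15 L).lDeltaTheta)
          (hm : rhoOfBiKummerData (T := C.thetaEnvData μ hC hS) R (ContinuousMulEquiv.refl _) k ∈ P.pre _),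
          (QuotientGroup.mk (P.proj _ ⟨rhoOfBiKummerData (T := C.thetaEnvData μ hC hS) R (ContinuousMulEquiv.refl _) k, hm⟩) :
              (ofThetaSettingDataQ μ hC hS h R K' constEmb constEmb_injective hinvc hinvp).lDeltaModN
                (ofThetaSettingDataQ μ hC hS h R K' constEmb constEmb_injective hinvc hinvp).BN) =
            ec ((C.rigidData μ hC hS h15 L).thetaMod ⟨k, hk⟩) := by
  have H := exists_coeffMap_autProj_ofThetaSetting μ hC hS R h15 L
  obtain ⟨e', he', hPe'⟩ := H
  refine ⟨e', he', fun k hk hm => ?_⟩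
  have h₂ : ((Functor.mapAut R.BN.base (connectedObjects (BTemp (C.temperedArithmeticGroup e).Pi)).ι).comp
      (rhoOfBiKummerData (T := C.thetaEnvData μ hC hS) R (ContinuousMulEquiv.refl _))) (k : C.Huu) ∈
        autPre (qSub D C.Huu) (ιTheta D l) R.BN.base.obj := by
    have h' : rhoOfBiKummerData (T := C.thetaEnvData μ hC hS) R (ContinuousMulEquiv.refl _) k ∈
        (autPre (qSub D C.Huu) (ιTheta D l) R.BN.base.obj).comap
          (Functor.mapAut R.BN.base (connectedObjects (BTemp (C.temperedArithmeticGroup e).Pi)).ι) := hPpre ▸ hm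
    exact Subgroup.mem_comap.1 h'
  exact (congrArg (QuotientGroup.mk (s := (powMonoidHom (N : ℕ) : LDelta (qSub D C.Huu) (ιTheta D l) R.BN.base.obj →*
      LDelta (qSub D C.Huu) (ιTheta D l) R.BN.base.obj).range)) (hPproj _ hm h₂)).trans (hPe' k hk h₂)

end Setting

end ThetaFrobenioid

end Literature.AnabelianGeometry.EtaleTheta

end
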